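import Summits.CriticalPhenomena.PercolationContinuityZ3.Theorems.PercNearOneGluingNoHeavyLowerTailAntitheticEarSpanBoxes
import Summits.CriticalPhenomena.PercolationContinuityZ3.Theorems.PercNearOneGluingNoHeavyLowerTailAntitheticEarSpanDom
import HarnessLib

/-!
# `NoHeavyLowerTail` (stmt-CriticalPhenomena-4575) — antithetic cluster pairs: the CYCLE + EAR ⊕-event is BOX-DECOMPOSABLE,
# P inside the span of the ear (THEOREM Θ², HOME/MEMO-gen63.md §3; prim-hp-2 gen 63)

Support file (`--supports stmt-CriticalPhenomena-4575`, hull-port prover `prim-hp-2`, gen 63).  No definitions, no named facts, no sorries;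
standard axioms.  Setting of …AntitheticEarTools: cycle `v 0 = s, …, v n = v 0` (`n ≥ 3`), ear `u 0 = v α, …, u ℓ = v β` (`ℓ ≥ 1`,
fresh interior, no ear pair a cycle pair), `E = Cyc.edgeSet n v ∪ Cyc.edgeSet ℓ u`, `P = v p` with `α < p < β`.

**`Antithetic.Cyc.ear_span_boxes`**: the ⊕-event `{T : P ∈ X_E T}` is a disjoint union of RED-DOMINATED BOXES with fixed pairs inside
`E` — packaged exactly as the hypotheses (cover / inside / uniqueness / domination, `Fix c ⊆ E`) of `Antithetic.Box.boxes_sum_nonneg`,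
`Antithetic.Box.mixed_of_oplus_boxes` (⊕ ⇒ M) and `Antithetic.Pendant.handle_vertex_sum_nonneg_of_boxes` (the ⊕-HANDLE THEOREM).  The boxes
are TOP, CELL `k`, FA `j k`, FB `j k` of …AntitheticEarSpanBoxes (cover, inside), red-dominated by …AntitheticEarSpanDom; uniqueness is
proved here (`Cyc.ear_span_uniq`: the family is read off from which of the arcs `[0,p)`, `[p,n)`, `[0,α)` are red, the parameters are
nearest blue pairs).  Consequence (with the ⊕-HANDLE THEOREM): the vertex antithetic inequality at `R = {x}` / CONJECTURE Δ2 for a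
θ-graph plus a handle one of whose ends is an interior vertex of a pole-to-pole path avoiding `s` — …AntitheticThetaHandle.
[cite: VandenbergHaggstromKahn2005, §1 p. 6 ("Harris' inequality"), §1 p. 3 (open cluster `C_s`)]
-/

noncomputable section

namespace Summit.CriticalPhenomena.PercolationContinuityZ3.Theorems

open Literature.Probability.Percolation
open scoped Classical

namespace Antithetic

namespace Cyc

variable {V : Type*} {n : ℕ} {v : ℕ → V} {ℓ : ℕ} {u : ℕ → V} {α β p : ℕ}

/-- **Uniqueness of the box (P inside the span), index form.**  Codes `(t, j, k)`: `t = 0` TOP, `t = 1` CELL `j`, `t = 2` FA `j k`,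
`t = 3` FB `j k`.  A colouring matches at most one valid code. [this work] -/
theorem ear_span_uniq (hαp : α < p) (hpβ : p < β) (hβn : β < n) (T : Set (Sym2 V)) {t j k t' j' k' : ℕ}
    (hv : (t = 0 ∧ j = 0 ∧ k = 0) ∨ (t = 1 ∧ j < p ∧ k = 0) ∨ (t = 2 ∧ α ≤ j ∧ j < p ∧ β ≤ k ∧ k < n) ∨
      (t = 3 ∧ p ≤ j ∧ j < β ∧ k < α))
    (hv' : (t' = 0 ∧ j' = 0 ∧ k' = 0) ∨ (t' = 1 ∧ j' < p ∧ k' = 0) ∨ (t' = 2 ∧ α ≤ j' ∧ j' < p ∧ β ≤ k' ∧ k' < n) ∨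
      (t' = 3 ∧ p ≤ j' ∧ j' < β ∧ k' < α))
    (hr : ∀ i, i < n → ((t = 0 ∧ i < p) ∨ (t = 1 ∧ j < i) ∨ (t = 2 ∧ (i < α ∨ (j < i ∧ i < k))) ∨
      (t = 3 ∧ ((k < i ∧ i < j) ∨ β ≤ i))) → edge v i ∈ T)
    (hb : ∀ i, i < n → ((t = 1 ∧ i = j) ∨ ((t = 2 ∨ t = 3) ∧ (i = j ∨ i = k))) → edge v i ∉ T)
    (hr' : ∀ i, i < n → ((t' = 0 ∧ i < p) ∨ (t' = 1 ∧ j' < i) ∨ (t' = 2 ∧ (i < α ∨ (j' < i ∧ i < k'))) ∨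
      (t' = 3 ∧ ((k' < i ∧ i < j') ∨ β ≤ i))) → edge v i ∈ T)
    (hb' : ∀ i, i < n → ((t' = 1 ∧ i = j') ∨ ((t' = 2 ∨ t' = 3) ∧ (i = j' ∨ i = k'))) → edge v i ∉ T) :
    t = t' ∧ j = j' ∧ k = k' := by
  -- which of the arcs `[0,p)`, `[p,n)`, `[0,α)` are red determines the family
  have tag : ∀ {t j k : ℕ},
      ((t = 0 ∧ j = 0 ∧ k = 0) ∨ (t = 1 ∧ j < p ∧ k = 0) ∨ (t = 2 ∧ α ≤ j ∧ j < p ∧ β ≤ k ∧ k < n) ∨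
        (t = 3 ∧ p ≤ j ∧ j < β ∧ k < α)) →
      (∀ i, i < n → ((t = 0 ∧ i < p) ∨ (t = 1 ∧ j < i) ∨ (t = 2 ∧ (i < α ∨ (j < i ∧ i < k))) ∨
        (t = 3 ∧ ((k < i ∧ i < j) ∨ β ≤ i))) → edge v i ∈ T) →
      (∀ i, i < n → ((t = 1 ∧ i = j) ∨ ((t = 2 ∨ t = 3) ∧ (i = j ∨ i = k))) → edge v i ∉ T) →
      ((t = 0 ↔ ∀ i, i < p → edge v i ∈ T) ∧
        (t = 1 ↔ (¬ (∀ i, i < p → edge v i ∈ T) ∧ ∀ i, p ≤ i → i < n → edge v i ∈ T)) ∧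
        (t = 2 → ∀ i, i < α → edge v i ∈ T) ∧ (t = 3 → ¬ ∀ i, i < α → edge v i ∈ T)) := by
    intro t j k hv hr hb
    rcases hv with ⟨rfl, rfl, rfl⟩ | ⟨rfl, hjp, rfl⟩ | ⟨rfl, hαj, hjp, hβk, hkn⟩ | ⟨rfl, hpj, hjβ, hkα⟩
    · have hD : ∀ i, i < p → edge v i ∈ T := fun i hi => hr i (by omega) (Or.inl ⟨rfl, hi⟩)
      exact ⟨⟨fun _ => hD, fun _ => rfl⟩, ⟨fun h => by omega, fun h => absurd hD h.1⟩, fun h => by omega, fun h => by omega⟩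
    · have hjb : edge v j ∉ T := hb j (by omega) (Or.inl ⟨rfl, rfl⟩)
      have hnD : ¬ ∀ i, i < p → edge v i ∈ T := fun h => hjb (h j hjp)
      have hO : ∀ i, p ≤ i → i < n → edge v i ∈ T := fun i hpi hin => hr i hin (Or.inr (Or.inl ⟨rfl, by omega⟩))
      exact ⟨⟨fun h => by omega, fun h => absurd h hnD⟩, ⟨fun _ => ⟨hnD, hO⟩, fun _ => rfl⟩, fun h => by omega, fun h => by omega⟩
    · have hjb : edge v j ∉ T := hb j (by omega) (Or.inr ⟨Or.inl rfl, Or.inl rfl⟩)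
      have hkb : edge v k ∉ T := hb k hkn (Or.inr ⟨Or.inl rfl, Or.inr rfl⟩)
      have hnD : ¬ ∀ i, i < p → edge v i ∈ T := fun h => hjb (h j hjp)
      have hnO : ¬ ∀ i, p ≤ i → i < n → edge v i ∈ T := fun h => hkb (h k (by omega) hkn)
      have hA : ∀ i, i < α → edge v i ∈ T := fun i hi => hr i (by omega) (Or.inr (Or.inr (Or.inl ⟨rfl, Or.inl hi⟩)))
      exact ⟨⟨fun h => by omega, fun h => absurd h hnD⟩, ⟨fun h => by omega, fun h => absurd h.2 hnO⟩, fun _ => hA,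
        fun h => by omega⟩
    · have hjb : edge v j ∉ T := hb j (by omega) (Or.inr ⟨Or.inr rfl, Or.inl rfl⟩)
      have hkb : edge v k ∉ T := hb k (by omega) (Or.inr ⟨Or.inr rfl, Or.inr rfl⟩)
      have hnD : ¬ ∀ i, i < p → edge v i ∈ T := fun h => hkb (h k (by omega))
      have hnO : ¬ ∀ i, p ≤ i → i < n → edge v i ∈ T := fun h => hjb (h j hpj (by omega))
      have hnA : ¬ ∀ i, i < α → edge v i ∈ T := fun h => hkb (h k hkα)
      exact ⟨⟨fun h => by omega, fun h => absurd h hnD⟩, ⟨fun h => by omega, fun h => absurd h.2 hnO⟩, fun h => by omega,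
        fun _ => hnA⟩
  obtain ⟨h0, h1, h2, h3⟩ := tag hv hr hb
  obtain ⟨h0', h1', h2', h3'⟩ := tag hv' hr' hb'
  have htt : t = t' := by
    rcases hv with ⟨ht, -⟩ | ⟨ht, -⟩ | ⟨ht, -⟩ | ⟨ht, -⟩ <;>
      rcases hv' with ⟨ht', -⟩ | ⟨ht', -⟩ | ⟨ht', -⟩ | ⟨ht', -⟩
    all_goals first
      | omega
      | exact absurd (h0'.2 (h0.1 ht)) (by omega)
      | exact absurd (h0.2 (h0'.1 ht')) (by omega)
      | exact absurd (h1'.2 (h1.1 ht)) (by omega)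
      | exact absurd (h1.2 (h1'.1 ht')) (by omega)
      | exact absurd (h2 ht) (h3' ht')
      | exact absurd (h2' ht') (h3 ht)
  subst htt
  refine ⟨rfl, ?_⟩
  rcases hv with ⟨rfl, rfl, rfl⟩ | ⟨rfl, hjp, rfl⟩ | ⟨rfl, hαj, hjp, hβk, hkn⟩ | ⟨rfl, hpj, hjβ, hkα⟩ <;>
    rcases hv' with ⟨h9, hj', hk'⟩ | ⟨h9, hj'p, hk'⟩ | ⟨h9, hαj', hj'p, hβk', hk'n⟩ | ⟨h9, hpj', hj'β, hk'α⟩ <;>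
    (try (exfalso; omega))
  · exact ⟨hj'.symm, hk'.symm⟩
  · -- CELL: both `j, j'` are the blue pair of `[0,p)` nearest to `P`
    refine ⟨?_, hk'.symm⟩
    by_contra hne
    rcases Nat.lt_or_gt_of_ne hne with h | h
    · exact hb' j' (by omega) (Or.inl ⟨rfl, rfl⟩) (hr j' (by omega) (Or.inr (Or.inl ⟨rfl, h⟩)))
    · exact hb j (by omega) (Or.inl ⟨rfl, rfl⟩) (hr' j (by omega) (Or.inr (Or.inl ⟨rfl, h⟩)))
  · -- FA
    have hjj : j = j' := by
      by_contra hne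
      rcases Nat.lt_or_gt_of_ne hne with h | h
      · exact hb' j' (by omega) (Or.inr ⟨Or.inl rfl, Or.inl rfl⟩)
          (hr j' (by omega) (Or.inr (Or.inr (Or.inl ⟨rfl, Or.inr ⟨h, by omega⟩⟩))))
      · exact hb j (by omega) (Or.inr ⟨Or.inl rfl, Or.inl rfl⟩)
          (hr' j (by omega) (Or.inr (Or.inr (Or.inl ⟨rfl, Or.inr ⟨h, by omega⟩⟩))))
    subst hjj
    refine ⟨rfl, ?_⟩
    by_contra hne
    rcases Nat.lt_or_gt_of_ne hne with h | h
    · exact hb k hkn (Or.inr ⟨Or.inl rfl, Or.inr rfl⟩)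
        (hr' k hkn (Or.inr (Or.inr (Or.inl ⟨rfl, Or.inr ⟨by omega, h⟩⟩))))
    · exact hb' k' hk'n (Or.inr ⟨Or.inl rfl, Or.inr rfl⟩)
        (hr k' hk'n (Or.inr (Or.inr (Or.inl ⟨rfl, Or.inr ⟨by omega, h⟩⟩))))
  · -- FB
    have hjj : j = j' := by
      by_contra hne
      rcases Nat.lt_or_gt_of_ne hne with h | h
      · exact hb j (by omega) (Or.inr ⟨Or.inr rfl, Or.inl rfl⟩)
          (hr' j (by omega) (Or.inr (Or.inr (Or.inr ⟨rfl, Or.inl ⟨by omega, h⟩⟩))))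
      · exact hb' j' (by omega) (Or.inr ⟨Or.inr rfl, Or.inl rfl⟩)
          (hr j' (by omega) (Or.inr (Or.inr (Or.inr ⟨rfl, Or.inl ⟨by omega, h⟩⟩))))
    subst hjj
    refine ⟨rfl, ?_⟩
    by_contra hne
    rcases Nat.lt_or_gt_of_ne hne with h | h
    · exact hb' k' (by omega) (Or.inr ⟨Or.inr rfl, Or.inr rfl⟩)
        (hr k' (by omega) (Or.inr (Or.inr (Or.inr ⟨rfl, Or.inl ⟨h, by omega⟩⟩))))
    · exact hb k (by omega) (Or.inr ⟨Or.inr rfl, Or.inr rfl⟩)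
        (hr' k (by omega) (Or.inr (Or.inr (Or.inr ⟨rfl, Or.inl ⟨h, by omega⟩⟩))))

/-- **THE ⊕-EVENT OF A CYCLE WITH AN EAR IS BOX-DECOMPOSABLE (P inside the span).**  Cycle `v 0 = s, …, v n = v 0` (`n ≥ 3`), ear
`u 0 = v α, …, u ℓ = v β` (`ℓ ≥ 1`, fresh interior, no ear pair a cycle pair), `E = Cyc.edgeSet n v ∪ Cyc.edgeSet ℓ u`, `P = v p` with
`α < p < β`.  Then there are an index type `C` and boxes `(Fix c, N c)` with `Fix c ⊆ E` such that: every colouring with `P ∈ X_E`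
lies in some box (cover); every member of a box has `P ∈ X_E` (inside); boxes are disjoint (uniqueness); and members `T, T'` of a box
opposite off `Fix c` satisfy `Y_E T' ⊆ X_E T` (red domination). [this work] -/
theorem ear_span_boxes (hn : 3 ≤ n) (hinj : ∀ i j, i < n → j < n → v i = v j → i = j) (hper : v n = v 0) (hℓ : 1 ≤ ℓ)
    (hαp : α < p) (hpβ : p < β) (hβn : β < n) (hu0 : u 0 = v α) (huℓ : u ℓ = v β)
    (hfresh : ∀ j, 0 < j → j < ℓ → ∀ i, i ≤ n → u j ≠ v i) (huinj : ∀ i j, i ≤ ℓ → j ≤ ℓ → u i = u j → i = j)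
    (hRC : ∀ m, m < ℓ → ∀ i, i < n → edge u m ≠ edge v i) :
    ∃ (C : Type) (Fix N : C → Set (Sym2 V)),
      (∀ c, Fix c ⊆ edgeSet n v ∪ edgeSet ℓ u) ∧
      (∀ T : Set (Sym2 V), v p ∈ openCluster (T ∩ (edgeSet n v ∪ edgeSet ℓ u)) (v 0) →
        ∃ c, ∀ e ∈ Fix c, (e ∈ T ↔ e ∈ N c)) ∧
      (∀ c (T : Set (Sym2 V)), (∀ e ∈ Fix c, (e ∈ T ↔ e ∈ N c)) →
        v p ∈ openCluster (T ∩ (edgeSet n v ∪ edgeSet ℓ u)) (v 0)) ∧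
      (∀ c c' (T : Set (Sym2 V)), (∀ e ∈ Fix c, (e ∈ T ↔ e ∈ N c)) → (∀ e ∈ Fix c', (e ∈ T ↔ e ∈ N c')) → c = c') ∧
      (∀ c (T T' : Set (Sym2 V)), (∀ e ∈ Fix c, (e ∈ T ↔ e ∈ N c)) → (∀ e ∈ Fix c, (e ∈ T' ↔ e ∈ N c)) →
        (∀ e ∉ Fix c, (e ∈ T' ↔ e ∉ T)) →
        openCluster (T'ᶜ ∩ (edgeSet n v ∪ edgeSet ℓ u)) (v 0) ⊆ openCluster (T ∩ (edgeSet n v ∪ edgeSet ℓ u)) (v 0)) := by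
  -- codes `(t, j, k)`: TOP `(0,0,0)`, CELL `(1,k,0)`, FA `(2,j,k)`, FB `(3,j,k)`
  let valid : ℕ × ℕ × ℕ → Prop := fun c =>
    (c.1 = 0 ∧ c.2.1 = 0 ∧ c.2.2 = 0) ∨ (c.1 = 1 ∧ c.2.1 < p ∧ c.2.2 = 0) ∨
      (c.1 = 2 ∧ α ≤ c.2.1 ∧ c.2.1 < p ∧ β ≤ c.2.2 ∧ c.2.2 < n) ∨ (c.1 = 3 ∧ p ≤ c.2.1 ∧ c.2.1 < β ∧ c.2.2 < α)
  let rdOf : ℕ × ℕ × ℕ → ℕ → Prop := fun c i =>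
    (c.1 = 0 ∧ i < p) ∨ (c.1 = 1 ∧ c.2.1 < i) ∨ (c.1 = 2 ∧ (i < α ∨ (c.2.1 < i ∧ i < c.2.2))) ∨
      (c.1 = 3 ∧ ((c.2.2 < i ∧ i < c.2.1) ∨ β ≤ i))
  let blOf : ℕ × ℕ × ℕ → ℕ → Prop := fun c i => (c.1 = 1 ∧ i = c.2.1) ∨ ((c.1 = 2 ∨ c.1 = 3) ∧ (i = c.2.1 ∨ i = c.2.2))
  let erOf : ℕ × ℕ × ℕ → Prop := fun c => c.1 = 2 ∨ c.1 = 3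
  let Fix : {c // valid c} → Set (Sym2 V) := fun c =>
    {e | ∃ i, i < n ∧ (rdOf c.1 i ∨ blOf c.1 i) ∧ e = edge v i} ∪ {e | erOf c.1 ∧ ∃ m, m < ℓ ∧ e = edge u m}
  let N : {c // valid c} → Set (Sym2 V) := fun c =>
    {e | ∃ i, i < n ∧ rdOf c.1 i ∧ e = edge v i} ∪ {e | erOf c.1 ∧ ∃ m, m < ℓ ∧ e = edge u m}
  have hFix : ∀ (c : {c // valid c}) e, e ∈ Fix c ↔
      (∃ i, i < n ∧ (rdOf c.1 i ∨ blOf c.1 i) ∧ e = edge v i) ∨ (erOf c.1 ∧ ∃ m, m < ℓ ∧ e = edge u m) := fun _ _ => Iff.rfl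
  have hN : ∀ (c : {c // valid c}) e, e ∈ N c ↔
      (∃ i, i < n ∧ rdOf c.1 i ∧ e = edge v i) ∨ (erOf c.1 ∧ ∃ m, m < ℓ ∧ e = edge u m) := fun _ _ => Iff.rfl
  have hdisj : ∀ c : {c // valid c}, ∀ i, i < n → ¬ (rdOf c.1 i ∧ blOf c.1 i) := by
    rintro ⟨⟨t, j, k⟩, hv⟩ i - ⟨h1, h2⟩
    simp only [valid, rdOf, blOf] at hv h1 h2
    omega
  have hmatch : ∀ (c : {c // valid c}) (T : Set (Sym2 V)), (∀ e ∈ Fix c, (e ∈ T ↔ e ∈ N c)) ↔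
      ((∀ i, i < n → rdOf c.1 i → edge v i ∈ T) ∧ (∀ i, i < n → blOf c.1 i → edge v i ∉ T) ∧
        (erOf c.1 → ∀ m, m < ℓ → edge u m ∈ T)) :=
    fun c T => dbox_matches_iff hn hinj hper hRC (rdOf c.1) (blOf c.1) (erOf c.1) (Fix c) (N c) (hFix c) (hN c) (hdisj c) T
  refine ⟨{c // valid c}, Fix, N, fun c => (dbox_sub (rdOf c.1) (blOf c.1) (erOf c.1) (Fix c) (N c) (hFix c) (hN c)).2,
    ?_, ?_, ?_, ?_⟩
  · -- cover
    intro T hP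
    rcases ear_span_cover hn hinj hper hℓ hαp hpβ hβn hu0 huℓ hfresh huinj T hP with
      hD | ⟨k, hkp, hkb, hkr⟩ | ⟨j, k, hαj, hjp, hβk, hkn, hjb, hkb, hred, hear⟩ | ⟨j, k, hpj, hjβ, hkα, hjb, hkb, hred, hear⟩
    · refine ⟨⟨(0, 0, 0), Or.inl ⟨rfl, rfl, rfl⟩⟩, (hmatch _ T).2 ⟨fun i hi h => ?_, fun i hi h => ?_, fun h => ?_⟩⟩
      · simp only [rdOf] at h; exact hD i (by omega)
      · simp only [blOf] at h; omega
      · simp only [erOf] at h; omega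
    · refine ⟨⟨(1, k, 0), Or.inr (Or.inl ⟨rfl, hkp, rfl⟩)⟩, (hmatch _ T).2 ⟨fun i hi h => ?_, fun i hi h => ?_, fun h => ?_⟩⟩
      · simp only [rdOf] at h; exact hkr i (by omega) hi
      · simp only [blOf] at h
        rw [show i = k by omega]; exact hkb
      · simp only [erOf] at h; omega
    · refine ⟨⟨(2, j, k), Or.inr (Or.inr (Or.inl ⟨rfl, hαj, hjp, hβk, hkn⟩))⟩,
        (hmatch _ T).2 ⟨fun i hi h => ?_, fun i hi h => ?_, fun _ => hear⟩⟩
      · simp only [rdOf] at h; exact hred i hi (by omega)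
      · simp only [blOf] at h
        rcases h with ⟨h, -⟩ | ⟨-, rfl | rfl⟩
        · omega
        · exact hjb
        · exact hkb
    · refine ⟨⟨(3, j, k), Or.inr (Or.inr (Or.inr ⟨rfl, hpj, hjβ, hkα⟩))⟩,
        (hmatch _ T).2 ⟨fun i hi h => ?_, fun i hi h => ?_, fun _ => hear⟩⟩
      · simp only [rdOf] at h; exact hred i hi (by omega)
      · simp only [blOf] at h
        rcases h with ⟨h, -⟩ | ⟨-, rfl | rfl⟩
        · omega
        · exact hjb
        · exact hkb
  · -- inside
    rintro ⟨⟨t, j, k⟩, hv⟩ T hT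
    obtain ⟨hr, -, he⟩ := (dbox_matches_iff hn hinj hper hRC (rdOf (t, j, k)) (blOf (t, j, k)) (erOf (t, j, k))
      (Fix ⟨(t, j, k), hv⟩) (N ⟨(t, j, k), hv⟩) (hFix _) (hN _) (hdisj ⟨(t, j, k), hv⟩) T).1 hT
    have hv₀ := hv
    simp only [valid] at hv₀
    rcases hv₀ with ⟨ht, hj, hk⟩ | ⟨ht, hjp, hk⟩ | ⟨ht, hαj, hjp, hβk, hkn⟩ | ⟨ht, hpj, hjβ, hkα⟩
    · exact mem_X_ear_of_lo (by omega) T fun i hi => hr i (by omega) (by simp only [rdOf]; omega)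
    · exact mem_X_ear_of_hi hper (by omega) T fun i hpi hin => hr i hin (by simp only [rdOf]; omega)
    · exact mem_X_ear_of_routeA hβn hαp.le hpβ.le hu0 huℓ T (fun i hi => hr i (by omega) (by simp only [rdOf]; omega))
        (he (by simp only [erOf]; omega)) (fun i hpi hiβ => hr i (by omega) (by simp only [rdOf]; omega))
    · exact mem_X_ear_of_routeB hper hβn hαp.le hpβ.le hu0 huℓ T
        (fun i hβi hin => hr i hin (by simp only [rdOf]; omega)) (he (by simp only [erOf]; omega))
        (fun i hαi hip => hr i (by omega) (by simp only [rdOf]; omega))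
  · -- uniqueness
    rintro ⟨⟨t, j, k⟩, hv⟩ ⟨⟨t', j', k'⟩, hv'⟩ T hT hT'
    obtain ⟨hr, hb, -⟩ := (hmatch _ T).1 hT
    obtain ⟨hr', hb', -⟩ := (hmatch _ T).1 hT'
    simp only [valid, rdOf, blOf] at hv hv' hr hb hr' hb'
    obtain ⟨h1, h2, h3⟩ := ear_span_uniq hαp hpβ hβn T hv hv' hr hb hr' hb'
    subst h1 h2 h3
    rfl
  · -- red domination
    rintro ⟨⟨t, j, k⟩, hv⟩ T T' hT hT' hflip
    have hv₀ := hv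
    simp only [valid] at hv₀
    rcases hv₀ with ⟨ht, hj, hk⟩ | ⟨ht, hjp, hk⟩ | ⟨ht, hαj, hjp, hβk, hkn⟩ | ⟨ht, hpj, hjβ, hkα⟩
    · exact dbox_dom hn hinj hper hRC (rdOf (t, j, k)) (blOf (t, j, k)) (erOf (t, j, k)) (Fix ⟨(t, j, k), hv⟩)
        (N ⟨(t, j, k), hv⟩) (hFix _) (hN _) (fun k₁ hk₁ hb => by simp only [blOf] at hb; omega) hT hT' hflip
    · exact dom_span_cell (rdOf (t, j, k)) (blOf (t, j, k)) (erOf (t, j, k)) (Fix ⟨(t, j, k), hv⟩) (N ⟨(t, j, k), hv⟩)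
        (hFix _) (hN _) hn hinj hper hℓ hαp hpβ hβn hu0 huℓ hfresh huinj hRC hjp
        (fun i => by simp only [rdOf]; omega) (fun i => by simp only [blOf]; omega) hT hT' hflip
    · exact dom_span_FA (rdOf (t, j, k)) (blOf (t, j, k)) (erOf (t, j, k)) (Fix ⟨(t, j, k), hv⟩) (N ⟨(t, j, k), hv⟩)
        (hFix _) (hN _) hn hinj hper hℓ hαp hpβ hβn hu0 huℓ hfresh huinj hRC hαj hjp hβk hkn
        (fun i => by simp only [rdOf]; omega) (fun i => by simp only [blOf]; omega) (by simp only [erOf]; omega) hT hT' hflip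
    · exact dom_span_FB (rdOf (t, j, k)) (blOf (t, j, k)) (erOf (t, j, k)) (Fix ⟨(t, j, k), hv⟩) (N ⟨(t, j, k), hv⟩)
        (hFix _) (hN _) hn hinj hper hℓ hαp hpβ hβn hu0 huℓ hfresh huinj hRC hpj hjβ hkα
        (fun i => by simp only [rdOf]; omega) (fun i => by simp only [blOf]; omega) (by simp only [erOf]; omega) hT hT' hflip

end Cyc

end Antithetic

end Summit.CriticalPhenomena.PercolationContinuityZ3.Theorems
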